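import Summits.QuantumFields.YangMills.Theorems.ColdStartUniversalityLatticeLangevinDoeblinHaarAllTimes
import HarnessLib

/-!
# Route `ColdStartUniversality` (fixed-cut-off SZZ dynamics): ★★ FULL SUPPORT / IRREDUCIBILITY OF THE TRANSITION LAWS AT EVERY POSITIVE TIME —
# `P(U_t ∈ O) ≥ c_t · Haar^E(O) > 0` for every non-empty open `O`, every start, every `t > 0`

Helper file (seat `ym-line-csu-p1`, g33; `--supports stmt-QuantumFields-24809`).  Direct reading of the Doeblin–Haar minorisation of THE transition
kernels (`doeblin_szz_haar_of_pos`: for every `t₀ > 0` there is `c ∈ (0,1]` with `c·Haar^E ≤ κ_t(z,·)` for all `z`, `t ≥ t₀`) for the SU(2) SZZ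
dynamics at any coupling:
* ★ `transition_apply_ge_haar` — `κ_t(x, A) ≥ c·Haar^E(A)` for every measurable `A`, every `x`, at the given time `t > 0`;
* ★★ `transition_apply_pos_of_isOpen` — the law of `U_t` has FULL SUPPORT for every `t > 0`: `κ_t(x, O) > 0` for every non-empty open `O`;
* ★★ `measure_mem_pos_of_isOpen` — solution form: for every strong solution `U` from a deterministic start on ANY space, `P(U_t ∈ O) > 0` for
  every non-empty open `O` and every `t > 0` — from the COLD START the dynamics reaches every region of configuration space immediately with
  positive probability (topological irreducibility at fixed cut-off).
THEOREMS ONLY, no definition, no sorry; [folklore].  HONEST FRAMING: fixed cut-off, `c` depends on `(L, β', t)`; `UniformColdStartMixing` (24809) is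
NOT restated; no crux, rung or summit statement is proved; the Yang–Mills mass gap is NOT proved.
-/

set_option autoImplicit false

noncomputable section

namespace Summit.QuantumFields.YangMills.Theorems.ColdStartUniversality

open MeasureTheory ProbabilityTheory Filter Topology
open scoped NNReal ENNReal BigOperators
open Literature Literature.Probability.Process Literature.MathematicalPhysics.QuantumFieldTheory
open Literature.MathematicalPhysics.QuantumLattice (fundamentalRep fundamentalLatticeRep continuous_fundamentalRep)

variable {L : ℕ} [NeZero L]

/-- ★ **Haar lower bound for the transition laws at a positive time**: for every `t > 0` there is `c ∈ (0,1]` with `κ_t(x, A) ≥ c·Haar^E(A)` for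
every start `x` and every measurable `A`. [folklore] -/
theorem transition_apply_ge_haar (β' : ℝ)
    (κ : ℝ≥0 → Kernel (GaugeConfig 3 L (Matrix.specialUnitaryGroup (Fin 2) ℂ))
      (GaugeConfig 3 L (Matrix.specialUnitaryGroup (Fin 2) ℂ))) [∀ t, IsMarkovKernel (κ t)]
    (hreal : ∀ (t : ℝ≥0) (x : GaugeConfig 3 L (Matrix.specialUnitaryGroup (Fin 2) ℂ))
        (Ω : Type) [MeasurableSpace Ω] (P : Measure Ω) [IsProbabilityMeasure P]
        (W : ℝ≥0 → Ω → (Edge 3 L × NoiseIdx 2 → ℝ)) (hW : IsFlatBrownian W P)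
        (U : ℝ≥0 → Ω → GaugeConfig 3 L (Matrix.specialUnitaryGroup (Fin 2) ℂ)),
        (∀ ω, U 0 ω = x) →
        (latticeLangevinDynamics (fundamentalLatticeRep 2) β').IsSolution (fundamentalRep (Fin 2))
          hW.natFiltration P W U →
        κ t x = P.map (U t))
    {t : ℝ≥0} (ht : 0 < (t : ℝ)) :
    ∃ c : ℝ, 0 < c ∧ c ≤ 1 ∧ ∀ (x : GaugeConfig 3 L (Matrix.specialUnitaryGroup (Fin 2) ℂ))
      (A : Set (GaugeConfig 3 L (Matrix.specialUnitaryGroup (Fin 2) ℂ))),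
      ENNReal.ofReal c * (Measure.pi fun _ : Edge 3 L => haarProbability (Matrix.specialUnitaryGroup (Fin 2) ℂ)) A ≤ κ t x A := by
  obtain ⟨c, hc, hc1, hmin⟩ := doeblin_szz_haar_of_pos (L := L) β' κ hreal (t₀ := t) ht
  refine ⟨c, hc, hc1, fun x A => ?_⟩
  have h := (Measure.le_iff'.1 (hmin x t le_rfl)) A
  rwa [Measure.smul_apply, smul_eq_mul] at h

/-- ★★ **Full support of the transition laws at every positive time**: `κ_t(x, O) > 0` for every non-empty open `O`, every start `x`, every `t > 0`.
[folklore] -/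
theorem transition_apply_pos_of_isOpen (β' : ℝ)
    (κ : ℝ≥0 → Kernel (GaugeConfig 3 L (Matrix.specialUnitaryGroup (Fin 2) ℂ))
      (GaugeConfig 3 L (Matrix.specialUnitaryGroup (Fin 2) ℂ))) [∀ t, IsMarkovKernel (κ t)]
    (hreal : ∀ (t : ℝ≥0) (x : GaugeConfig 3 L (Matrix.specialUnitaryGroup (Fin 2) ℂ))
        (Ω : Type) [MeasurableSpace Ω] (P : Measure Ω) [IsProbabilityMeasure P]
        (W : ℝ≥0 → Ω → (Edge 3 L × NoiseIdx 2 → ℝ)) (hW : IsFlatBrownian W P)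
        (U : ℝ≥0 → Ω → GaugeConfig 3 L (Matrix.specialUnitaryGroup (Fin 2) ℂ)),
        (∀ ω, U 0 ω = x) →
        (latticeLangevinDynamics (fundamentalLatticeRep 2) β').IsSolution (fundamentalRep (Fin 2))
          hW.natFiltration P W U →
        κ t x = P.map (U t))
    {t : ℝ≥0} (ht : 0 < (t : ℝ)) (x : GaugeConfig 3 L (Matrix.specialUnitaryGroup (Fin 2) ℂ))
    {O : Set (GaugeConfig 3 L (Matrix.specialUnitaryGroup (Fin 2) ℂ))} (hO : IsOpen O) (hne : O.Nonempty) :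
    0 < κ t x O := by
  haveI : (haarProbability (Matrix.specialUnitaryGroup (Fin 2) ℂ)).IsOpenPosMeasure := by
    unfold haarProbability; infer_instance
  haveI : (Measure.pi fun _ : Edge 3 L => haarProbability (Matrix.specialUnitaryGroup (Fin 2) ℂ)).IsOpenPosMeasure := by infer_instance
  obtain ⟨c, hc, -, hle⟩ := transition_apply_ge_haar (L := L) β' κ hreal ht
  have hH : 0 < (Measure.pi fun _ : Edge 3 L => haarProbability (Matrix.specialUnitaryGroup (Fin 2) ℂ)) O := hO.measure_pos _ hne
  have hpos : 0 < ENNReal.ofReal c * (Measure.pi fun _ : Edge 3 L => haarProbability (Matrix.specialUnitaryGroup (Fin 2) ℂ)) O :=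
    ENNReal.mul_pos (ENNReal.ofReal_pos.2 hc).ne' hH.ne'
  exact lt_of_lt_of_le hpos (hle x O)

/-- ★★ **Irreducibility along every strong solution**: for every strong solution `U` of the SU(2) SZZ dynamics from a deterministic start on any
space, every `t > 0` and every non-empty open `O`: `P(U_t ∈ O) > 0` — from the cold start every region of configuration space is reached with
positive probability at every positive time. [folklore] -/
theorem measure_mem_pos_of_isOpen (L : ℕ) [NeZero L] (β' : ℝ)
    (x : GaugeConfig 3 L (Matrix.specialUnitaryGroup (Fin 2) ℂ))
    {Ω : Type} [MeasurableSpace Ω] {P : Measure Ω} [IsProbabilityMeasure P]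
    {W : ℝ≥0 → Ω → (Edge 3 L × NoiseIdx 2 → ℝ)} (hW : IsFlatBrownian W P)
    {U : ℝ≥0 → Ω → GaugeConfig 3 L (Matrix.specialUnitaryGroup (Fin 2) ℂ)} (hU0 : ∀ ω, U 0 ω = x)
    (hU : (latticeLangevinDynamics (fundamentalLatticeRep 2) β').IsSolution (fundamentalRep (Fin 2)) hW.natFiltration P W U)
    {t : ℝ≥0} (ht : 0 < (t : ℝ)) {O : Set (GaugeConfig 3 L (Matrix.specialUnitaryGroup (Fin 2) ℂ))} (hO : IsOpen O) (hne : O.Nonempty) :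
    0 < P {ω | U t ω ∈ O} := by
  classical
  haveI := secondCountableTopology_su2
  haveI := borelSpace_config L
  obtain ⟨κ, hκM, -, hreal⟩ := exists_transitionKernel L β'
  haveI := hκM
  have hmU : Measurable (U t) := (hU.adapted t).mono (hW.natFiltration.le t) le_rfl
  have h := transition_apply_pos_of_isOpen (L := L) β' κ hreal ht x hO hne
  rw [hreal t x Ω P W hW U hU0 hU, Measure.map_apply hmU hO.measurableSet] at h
  exact h

end Summit.QuantumFields.YangMills.Theorems.ColdStartUniversality

end
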